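import Literature.ModelTheory.FiniteModelTheory.TseitinColouring
import Literature.ModelTheory.FiniteModelTheory.CkEquivTransfer
import Literature.ModelTheory.FiniteModelTheory.CountingWidth
import Literature.Computability.Complexity.RoundInstance
import HarnessLib

/-!
# Linear counting width of 3-colourability: the discharge of `AtseriasDawarOchremiak2021_threeColourability_countingWidth`

Topic `Literature/ModelTheory/FiniteModelTheory`; proofs file for `CountingWidth.lean`. PROVES the named fact
`AtseriasDawarOchremiak2021_threeColourability_countingWidth` (Atserias–Dawar–Ochremiak 2021, §5.2, Lemma 13
of arXiv:1901.07825, unrestricted classes, invariance form): there is `d > 0` such that for all large `n` and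
every `k`, if 3-colourability is `≡^{C^k}`-invariant on graphs on `Fin n` then `d n ≤ k`.

Assembly (`TseitinColouring.Params`, an abstract family of constant-degree edge expanders on every number of
vertices; instantiated by `zigzagParams` = the tree's explicit zig-zag family `Expander.Family.X`,
`Expander.Family.edgeExpansion_X`, Reingold–Vadhan–Wigderson 2002 via `ExpanderFamily.lean`/`RoundInstance.lean`):
for `n ≥ N₀` put `m = (n-3)/per d`, pad the Tseitin 3-colouring graphs `H(X m, c)` (`TseitinColouring.lean`)
with `(n-3) % per d` isolated vertices and transport to `Fin n` (`bigGraph`); with zero charges the graph is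
3-colourable, with an odd charge it is not; the two are `≡^{C^K}` for `K = ⌊η m/(4d)⌋`
(`TseitinColouring.ckEquiv_graph`, `CkEquiv.sum` for the padding, `CkEquiv.iso_congr` for the transport), and
`K ≥ d' n` for `d' = η/(8 d per d)` (`dc_mul_le_Kn`); `CkEquiv.mono` finishes.

## References

* A. Atserias, A. Dawar, J. Ochremiak, *On the power of symmetric linear programs*, J. ACM 68 (2021) Art. 26,
  arXiv:1901.07825, §5.2, Lemma 13 (and Theorem 3). Read: arXiv pp. 21–22.
* A. Atserias, A. Dawar, *Definable inapproximability: new challenges for duplicator*, J. Log. Comput. 29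
  (2019), arXiv:1806.11307, Lemma 3.2, Thm 3.7.
* O. Reingold, S. Vadhan, A. Wigderson, *Entropy waves, the zig-zag graph product, and new constant-degree
  expanders*, Ann. of Math. 155 (2002), Thm 3.3 (through `Literature.Computability.Complexity.ExpanderFamily`).
-/

namespace Literature.ModelTheory.FiniteModelTheory.TseitinColouring

open Finset Filter
open Literature.Computability.Complexity.Expander

/-- **A family of constant-degree edge expanders, one on every number of vertices** — the input of the
construction (instantiated below with the zig-zag family `Expander.Family.X`). [folklore] -/
structure Params where
  /-- the degree -/
  d : ℕ
  two_le : 2 ≤ d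
  /-- the edge-expansion constant -/
  η : ℝ
  /-- the `d`-regular rotation map on `Fin m` -/
  R : (m : ℕ) → RotGraph m d
  expands : ∀ m, EdgeExpansion (R m) η

namespace Params

variable (P : Params)

/-- The degree is at least `1`. [folklore] -/
theorem one_le : 1 ≤ P.d := le_trans (by norm_num) P.two_le

/-- The expansion constant is positive. [folklore] -/
theorem η_pos : 0 < P.η := (P.expands 0).pos

/-- The order of the base expander used for `n`-vertex graphs. [folklore] -/
def mOf (n : ℕ) : ℕ := (n - 3) / per P.d

/-- The number of isolated padding vertices. [folklore] -/
def jOf (n : ℕ) : ℕ := (n - 3) % per P.d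

/-- `m · per d + 3 + j = n` for `n ≥ 3`. [folklore] -/
theorem mOf_spec {n : ℕ} (hn : 3 ≤ n) : P.mOf n * per P.d + 3 + P.jOf n = n := by
  have := Nat.div_add_mod' (n - 3) (per P.d)
  unfold mOf jOf
  omega

/-- The padded vertex set has exactly `n` elements. [folklore] -/
theorem card_padded {n : ℕ} (hn : 3 ≤ n) :
    Fintype.card (Vert (P.mOf n) P.d ⊕ Fin (P.jOf n)) = Fintype.card (Fin n) := by
  rw [Fintype.card_sum, card_vert, Fintype.card_fin, Fintype.card_fin, P.mOf_spec hn]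

/-- The identification of the padded vertex set with `Fin n`. [folklore] -/
noncomputable def eqv (n : ℕ) (hn : 3 ≤ n) : Vert (P.mOf n) P.d ⊕ Fin (P.jOf n) ≃ Fin n :=
  Fintype.equivOfCardEq (P.card_padded hn)

/-- The padded Tseitin 3-colouring graph over `R (mOf n)` with charges `c`, on `Fin n`. [folklore] -/
noncomputable def bigGraph (n : ℕ) (hn : 3 ≤ n) (c : Fin (P.mOf n) → ZMod 2) : SimpleGraph (Fin n) :=
  (graph (P.R (P.mOf n)) c ⊕g (⊥ : SimpleGraph (Fin (P.jOf n)))).map (P.eqv n hn)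

/-- **The padded graphs with arbitrary and with zero charges are `≡^{C^K}`** for `2dK < η m` (Duplicator's strategy on the Tseitin part, the identity on the padding, transported to `Fin n`). [folklore] -/
theorem ckEquiv_bigGraph {n : ℕ} (hn : 3 ≤ n) (hm : 2 ≤ P.mOf n) {K : ℕ}
    (hK : (2 * P.d * K : ℝ) < P.η * P.mOf n) (c : Fin (P.mOf n) → ZMod 2) :
    CkEquiv K (P.bigGraph n hn c) (P.bigGraph n hn 0) :=
  (CkEquiv.sum (ckEquiv_graph (P.expands _) c hm P.one_le hK)
    (CkEquiv.refl (⊥ : SimpleGraph (Fin (P.jOf n))) K)).iso_congr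
    (SimpleGraph.Iso.map (P.eqv n hn) _) (SimpleGraph.Iso.map (P.eqv n hn) _)

/-- The padded graph with zero charges is 3-colourable. [folklore] -/
theorem colorable_bigGraph_zero {n : ℕ} (hn : 3 ≤ n) : (P.bigGraph n hn 0).Colorable 3 := by
  have h : (graph (P.R (P.mOf n)) 0 ⊕g (⊥ : SimpleGraph (Fin (P.jOf n)))).Colorable 3 :=
    SimpleGraph.colorable_sum.2 ⟨colorable_zero, (SimpleGraph.colorable_one_iff.2 rfl).mono (by norm_num)⟩
  exact SimpleGraph.Colorable.of_hom (SimpleGraph.Iso.map (P.eqv n hn) _).symm.toHom h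

/-- The odd charge: `1` at the first vertex. [folklore] -/
def oddCharge (n : ℕ) (hm : 1 ≤ P.mOf n) : Fin (P.mOf n) → ZMod 2 := fun w => if w = ⟨0, hm⟩ then 1 else 0

/-- The padded graph with an odd charge is not 3-colourable. [folklore] -/
theorem not_colorable_bigGraph {n : ℕ} (hn : 3 ≤ n) (hm : 1 ≤ P.mOf n) :
    ¬ (P.bigGraph n hn (P.oddCharge n hm)).Colorable 3 := by
  intro h
  have h' : (graph (P.R (P.mOf n)) (P.oddCharge n hm)).Colorable 3 :=
    SimpleGraph.Colorable.of_hom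
      ((SimpleGraph.Iso.map (P.eqv n hn) _).toHom.comp SimpleGraph.Embedding.sumInl.toHom) h
  refine not_colorable_of_sum_ne_zero P.two_le ?_ h'
  simp [oddCharge]

/-! ### The constants -/

/-- The linear coefficient `d = η / (8 d · per d)`. [folklore] -/
noncomputable def dc : ℝ := P.η / (8 * P.d * per P.d)

/-- The degree is positive (as a real number). [folklore] -/
theorem d_pos_real : (0 : ℝ) < P.d := by exact_mod_cast lt_of_lt_of_le Nat.one_pos P.one_le

/-- `per d` is positive (as a real number). [folklore] -/
theorem per_pos_real : (0 : ℝ) < per P.d := by exact_mod_cast per_pos P.d P.one_le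

/-- The linear coefficient is positive. [folklore] -/
theorem dc_pos : 0 < P.dc := by
  unfold dc
  exact div_pos P.η_pos (mul_pos (mul_pos (by norm_num) P.d_pos_real) P.per_pos_real)

/-- The number of pebbles at order `n`: `⌊η m / (4 d)⌋`. [folklore] -/
noncomputable def Kn (n : ℕ) : ℕ := ⌊P.η * P.mOf n / (4 * P.d)⌋₊

/-- The pebble number satisfies the hypothesis `2 d K < η m` of the strategy (`m ≥ 1`). [folklore] -/
theorem Kn_lt {n : ℕ} (hm : 1 ≤ P.mOf n) : (2 * P.d * P.Kn n : ℝ) < P.η * P.mOf n := by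
  have hη := P.η_pos
  have hd := P.d_pos_real
  have hmR : (1 : ℝ) ≤ P.mOf n := by exact_mod_cast hm
  have hpos : 0 < P.η * P.mOf n := mul_pos hη (by linarith)
  have hx : (0 : ℝ) ≤ P.η * P.mOf n / (4 * P.d) := div_nonneg hpos.le (by linarith)
  have hfl : (P.Kn n : ℝ) ≤ P.η * P.mOf n / (4 * P.d) := Nat.floor_le hx
  calc (2 * P.d * P.Kn n : ℝ) ≤ 2 * P.d * (P.η * P.mOf n / (4 * P.d)) := by gcongr
    _ = P.η * P.mOf n / 2 := by field_simp; ring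
    _ < P.η * P.mOf n := by linarith

/-- The threshold. [folklore] -/
noncomputable def N₀ : ℕ := max (2 * per P.d + 3) ⌈8 * (P.d : ℝ) * per P.d / P.η + 4 + 2 * per P.d⌉₊

/-- Orders beyond the threshold are at least `3`. [folklore] -/
theorem three_le_of_N₀_le {n : ℕ} (hn : P.N₀ ≤ n) : 3 ≤ n := by
  have : 2 * per P.d + 3 ≤ n := le_trans (le_max_left _ _) hn
  omega

/-- Beyond the threshold the base expander has at least two vertices. [folklore] -/
theorem two_le_mOf {n : ℕ} (hn : P.N₀ ≤ n) : 2 ≤ P.mOf n := by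
  have h : 2 * per P.d + 3 ≤ n := le_trans (le_max_left _ _) hn
  unfold mOf
  exact (Nat.le_div_iff_mul_le (per_pos P.d P.one_le)).2 (by omega)

/-- **Beyond the threshold, `d · n ≤ K(n)`.** [folklore] -/
theorem dc_mul_le_Kn {n : ℕ} (hn : P.N₀ ≤ n) : P.dc * n ≤ P.Kn n := by
  have hη := P.η_pos
  have hd := P.d_pos_real
  have hP := P.per_pos_real
  have hn3 : 3 ≤ n := P.three_le_of_N₀_le hn
  -- `per · m ≥ n - 2 - per`
  have h1 : (n : ℝ) - 2 - per P.d ≤ per P.d * P.mOf n := by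
    have hs := P.mOf_spec hn3
    have hj : P.jOf n < per P.d := Nat.mod_lt _ (per_pos P.d P.one_le)
    have hsR : ((P.mOf n * per P.d + 3 + P.jOf n : ℕ) : ℝ) = n := by exact_mod_cast hs
    push_cast at hsR
    have hjR : (P.jOf n : ℝ) + 1 ≤ per P.d := by exact_mod_cast hj
    nlinarith
  -- `n ≥ 8 d per / η + 4 + 2 per`
  have h2 : 8 * (P.d : ℝ) * per P.d / P.η + 4 + 2 * per P.d ≤ n := by
    have : ⌈8 * (P.d : ℝ) * per P.d / P.η + 4 + 2 * per P.d⌉₊ ≤ n := le_trans (le_max_right _ _) hn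
    exact (Nat.le_ceil _).trans (by exact_mod_cast this)
  have h2' : 8 * (P.d : ℝ) * per P.d + (4 + 2 * per P.d) * P.η ≤ P.η * n := by
    have := mul_le_mul_of_nonneg_left h2 hη.le
    rw [mul_add, mul_add, mul_div_cancel₀ _ hη.ne'] at this
    linarith
  -- the target in cleared form: `dc n + 1 ≤ η m / (4 d)`
  have h4d : (0 : ℝ) < 4 * P.d := by linarith
  have h2p : (0 : ℝ) < 2 * per P.d := by linarith
  have key : P.dc * n + 1 ≤ P.η * P.mOf n / (4 * P.d) := by
    rw [dc, le_div_iff₀ h4d]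
    have e1 : P.η / (8 * P.d * per P.d) * n * (4 * P.d) = P.η * n / (2 * per P.d) := by
      field_simp; ring
    rw [add_mul, e1, one_mul, div_add' _ _ _ h2p.ne', div_le_iff₀ h2p]
    have h1' := mul_le_mul_of_nonneg_left h1 hη.le
    nlinarith
  have hfl : P.η * P.mOf n / (4 * P.d) - 1 < P.Kn n := Nat.sub_one_lt_floor _
  linarith

include P in
/-- **The conclusion for an abstract expander family.** [folklore] -/
theorem threeColourability_countingWidth : AtseriasDawarOchremiak2021_threeColourability_countingWidth := by
  refine ⟨P.dc, P.dc_pos, ?_⟩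
  rw [Filter.eventually_atTop]
  refine ⟨P.N₀, fun n hn k hk => ?_⟩
  have hn3 : 3 ≤ n := P.three_le_of_N₀_le hn
  have hm2 : 2 ≤ P.mOf n := P.two_le_mOf hn
  have hm1 : 1 ≤ P.mOf n := le_trans (by norm_num) hm2
  by_contra hlt
  push Not at hlt
  have hkK : k ≤ P.Kn n := by
    have : (k : ℝ) < P.Kn n := hlt.trans_le (P.dc_mul_le_Kn hn)
    exact_mod_cast this.le
  have hequiv := (P.ckEquiv_bigGraph hn3 hm2 (P.Kn_lt hm1) (P.oddCharge n hm1)).mono hkK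
  exact P.not_colorable_bigGraph hn3 hm1 ((hk _ _ hequiv).2 (P.colorable_bigGraph_zero hn3))

end Params

/-! ### The explicit family -/

open Literature.Computability.Complexity.Expander.Family in
/-- The degree `d₀ = 2B · D²` of the zig-zag cloud expanders is at least `2`. [folklore] -/
theorem two_le_d₀ : 2 ≤ d₀ := by
  have hB := two_le_B
  have hD := two_le_D
  unfold d₀ Cq
  calc 2 ≤ 2 * 2 * (2 * 2) := by norm_num
    _ ≤ 2 * B * (D * D) := by gcongr

open Literature.Computability.Complexity.Expander.Family in
/-- **The explicit parameters**: the zig-zag expanders `Expander.Family.X m` (Reingold–Vadhan–Wigderson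
2002, Thm 3.3, contracted to every order; edge expansion `η`, degree `d₀`). [cite: ReingoldVadhanWigderson2002, Thm. 3.3] -/
noncomputable def zigzagParams : Params where
  d := d₀
  two_le := two_le_d₀
  η := η
  R := X
  expands := fun m => ⟨η_pos, fun Q hQ => edgeExpansion_X m Q hQ⟩

end Literature.ModelTheory.FiniteModelTheory.TseitinColouring

namespace Literature.ModelTheory.FiniteModelTheory

/-- **Linear counting width of 3-colourability (Atserias–Dawar–Ochremiak 2021, §5.2, Lemma 13 of
arXiv:1901.07825), proved.** With the explicit zig-zag expanders: for `d = η/(8 d₀ per d₀)` and all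
`n ≥ N₀`, the padded Tseitin 3-colouring graphs over `X ((n-3)/per d₀)` with zero resp. odd charge are
`n`-vertex graphs, the first 3-colourable, the second not, and `≡^{C^K}` for `K = ⌊η m/(4 d₀)⌋ ≥ d n`; so
3-colourability is `≡^{C^k}`-invariant on `Fin n` only when `d n ≤ k`. The printed proof (the 3-XOR lower
bound, Thm 3 of the source = Atserias–Dawar 2019 Thm 3.7, composed with the quantifier-free 3-SAT →
3-colouring reduction) is followed with the CFI/Tseitin parity system of an explicit constant-degree
expander as the 3-XOR instance, Duplicator's strategy from local consistency (Atserias–Dawar 2019,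
Lemma 3.2) and the gadget reduction fused into the graphs `TseitinColouring.graph`.
[cite: AtseriasDawarOchremiak2021, §5.2, Lemma 13 of arXiv:1901.07825] -/
theorem AtseriasDawarOchremiak2021_threeColourability_countingWidth_holds :
    AtseriasDawarOchremiak2021_threeColourability_countingWidth :=
  TseitinColouring.zigzagParams.threeColourability_countingWidth

end Literature.ModelTheory.FiniteModelTheory
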